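import Mathlib
import Summits.Ventures.HodgeRepro.Tier4.Line4.ChainInputsGlobal
import Summits.Ventures.HodgeRepro.Tier4.Line4.LevelDCFinFactor

/-!
# Tier4/Line4/ChainInputsWitness — C-L4-CHAININPUTS-GLOBAL, part 3: the bundle `ChainInputs` AT THE WITNESS OF RECORD
`f N = (finf ⊗ ffinMuNat (lev N)) ∗ testNat e (lev N)`, modulo (B1) and the FIN / ARCH clauses

Blind re-derivation cell `pub-hodge-repro`, Tier 4 «prove the step» (README §9–§10), seat t4-L2-p3 (gen 5; plan-4 g6's
cut S15809 / S15814, «the assembly … L2-p3's last theorem in ChainInputsGlobal (after FIN/ARCH land)»).  Tree path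
`lean/Summits/Ventures/HodgeRepro/Tier4/Line4/ChainInputsWitness.lean`.  Imports this seat's ChainInputsGlobal
(`chainInputs_of_pieces`) and L1-p1 / L4-p1's LevelDCFinFactor (`isFinFactor_levelDC`, consumed by name).

* `witness_isProductFn`: the witness is the product `(c₀ · (finf ∗ e)) ⊗ levelDC (lev N)` — MainTermInstance's internal
  product form, stated (`ffinMuNat_lev`, `isProductFn_conv'`, `testNat_of_ne_zero`, `convFin_ffinMu_levelInd`);
* **`chainInputs_witness_of_pieces`**: `hchain N` of TailGlueMain, i.e. `ChainInputs` at the witness, from display (8)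
  `PoincareOfDecay` (through the bridge, with `HasDecay3` of the archimedean factor), the continuity and bound of the
  archimedean factor (L4-x2's ConvInfRegularity), and (B1) + the FIN / ARCH clauses (L1-p1's ChainInputsFin, IntegArch) —
  all of them HYPOTHESES here, bound by name at the assembly.

No printed input is consumed.  HC_CM is NOT proved by anyone in this repository.
-/

set_option autoImplicit false
noncomputable section
namespace Summit.Ventures.HodgeRepro.Tier4.Line4
open Summit.Ventures.HodgeRepro.Tier4 Summit.Ventures.HodgeRepro.Tier4.Common
  Summit.Ventures.HodgeRepro.Tier4.Line1 MeasureTheory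
open scoped ComplexConjugate Topology Pointwise NNReal

section Witness
variable {k : Type} [Field k] [NumberField k] (W : PlaneData k) [MeasurableSpace (GA W)] [BorelSpace (GA W)]

variable (R : RTFData W)

/-- **the witness is a product test function**: `(finf ⊗ ffinMuNat (lev N)) ∗ testNat e (lev N) =
(c₀ · (finf ∗ e)) ⊗ levelDC (lev N)` (MainTermInstance's internal product form, stated). -/
theorem witness_isProductFn (μ : Measure (GA W)) [μ.IsHaarMeasure] (DG : Set (GA W))
    (fdG : IsFundamentalDomain (rationalPoints W) DG μ) (compG : IsCompact (closure DG))
    [R.μT.IsHaarMeasure] [R.μT'.IsHaarMeasure] (compT : IsCompact (closure R.DT)) (compT' : IsCompact (closure R.DT'))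
    (γ₀ : GA W) (μinf : Measure (infinitePart W)) [μinf.IsHaarMeasure] (μ₀ : Measure (finitePart W))
    [μ₀.IsHaarMeasure] (c₀ : ℝ≥0) (hcμ₀ : μ = c₀ • Measure.map (gaSplit W).symm (μinf.prod μ₀))
    (finf e : GA W → ℂ) (p n₁ N : ℕ) (hp : p ≠ 0) :
    IsProductFn W
      ((Setting.ofAdelicData W R μ DG fdG compG compT compT').conv
        (L1Class.prodFn W finf (ffinMuNat W μ₀ γ₀ (fun n => p ^ (n + n₁)) (p ^ (N + n₁))))
        (testNat W e (p ^ (N + n₁))))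
      (fun x => (c₀ : ℂ) * convInf W μinf finf e x) (levelDC W γ₀ (p ^ (N + n₁))) := by
  intro g
  have hN : p ^ (N + n₁) ≠ 0 := pow_ne_zero _ hp
  have hlev : ffinMuNat W μ₀ γ₀ (fun n => p ^ (n + n₁)) (p ^ (N + n₁)) = ffinMu W μ₀ γ₀ (p ^ (N + n₁)) :=
    ffinMuNat_lev W μ₀ γ₀ (lev := fun n => p ^ (n + n₁)) (n := N) hN
  have hprod := isProductFn_conv' W μ μinf μ₀ c₀ hcμ₀
    (L1Class.isProductFn_prodFn W finf (ffinMuNat W μ₀ γ₀ (fun n => p ^ (n + n₁)) (p ^ (N + n₁))))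
    (L1Class.isProductFn_prodFn W e (levelInd W (p ^ (N + n₁)))) g
  rw [testNat_of_ne_zero W e hN]
  change conv W μ _ _ g = _
  rw [hprod, hlev, convFin_ffinMu_levelInd W γ₀ (p ^ (N + n₁)) μ₀ hN, levelDC_ofFinPart]

/-- **`ChainInputs` AT THE WITNESS OF RECORD** — TailGlueMain's `hchain N` as a THEOREM modulo: display (8)
`PoincareOfDecay` (with `HasDecay3` of the archimedean factor `c₀ · (finf ∗ e)`), the continuity and a bound of that
factor (L4-x2's ARCH), and (B1) + the FIN / ARCH clauses `hA hB hIinf hIfin hint` (L1-p1 / L4-x2) — every one of them a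
hypothesis bound by name at the assembly; the nine GLOBAL clauses are `chainInputs_of_pieces`. -/
theorem chainInputs_witness_of_pieces [CompactSpace (torusInf' W)] (μ : Measure (GA W)) [μ.IsHaarMeasure]
    (DG : Set (GA W)) (fdG : IsFundamentalDomain (rationalPoints W) DG μ) (compG : IsCompact (closure DG))
    [R.μT.IsHaarMeasure] [R.μT'.IsHaarMeasure] (compT : IsCompact (closure R.DT)) (compT' : IsCompact (closure R.DT'))
    (hR : R.IsHaar) (hc : Continuous R.chi) (hu : ∀ a, ‖R.chi a‖ = 1) (hc' : Continuous R.chi')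
    (hu' : ∀ a, ‖R.chi' a‖ = 1) (γ₀ : rationalPoints W)
    (νinf : Measure (torusInf W)) (νf : Measure (torusFin W)) (νinf' : Measure (torusInf' W))
    (νf' : Measure (torusFin' W)) (DZf : Set (torusFin W))
    (μinf : Measure (infinitePart W)) [μinf.IsHaarMeasure] (μ₀ : Measure (finitePart W)) [μ₀.IsHaarMeasure]
    (c₀ : ℝ≥0) (hcμ₀ : μ = c₀ • Measure.map (gaSplit W).symm (μinf.prod μ₀))
    (finf e : GA W → ℂ) (p n₁ N : ℕ) (hp : p ≠ 0)
    (h8 : L1Class.PoincareOfDecay W (Setting.ofAdelicData W R μ DG fdG compG compT compT'))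
    (hFinfc : Continuous fun x => (c₀ : ℂ) * convInf W μinf finf e x)
    (hdec : L1Class.HasDecay3 W fun x => (c₀ : ℂ) * convInf W μinf finf e x)
    (C : ℝ) (hC : ∀ x, ‖(c₀ : ℂ) * convInf W μinf finf e x‖ ≤ C)
    (hB1 : IntegrableOn (fun t : torusT W => R.chi t * innerFull W R
      ((Setting.ofAdelicData W R μ DG fdG compG compT compT').conv
        (L1Class.prodFn W finf (ffinMuNat W μ₀ (γ₀ : GA W) (fun n => p ^ (n + n₁)) (p ^ (N + n₁))))
        (testNat W e (p ^ (N + n₁)))) (γ₀ : GA W) t) (prodDomain W DZf) R.μT)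
    (hA : ∀ t : torusT W, Integrable (fun a : torusInf' W => conj (R.chi' (a : torusT' W)) *
      ((c₀ : ℂ) * convInf W μinf finf e ((GA.ofInfPart W t)⁻¹ * GA.ofInfPart W (γ₀ : GA W) * ((a : torusT' W) : GA W))))
      νinf')
    (hB : ∀ t : torusT W, Integrable (fun b : torusFin' W => conj (R.chi' (b : torusT' W)) *
      levelDC W (γ₀ : GA W) (p ^ (N + n₁)) ((GA.ofFinPart W t)⁻¹ * GA.ofFinPart W (γ₀ : GA W) * ((b : torusT' W) : GA W)))
      νf')
    (hIinf : Integrable (fun a : torusInf W => R.chi a *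
      innerInf W R (fun x => (c₀ : ℂ) * convInf W μinf finf e x) (γ₀ : GA W) νinf' a) νinf)
    (hIfin : IntegrableOn (fun b : torusFin W => R.chi b *
      innerFin W R (levelDC W (γ₀ : GA W) (p ^ (N + n₁))) (γ₀ : GA W) νf' b) DZf νf)
    (hint : IntegrableOn (fun q : torusFin W × torusFin' W => R.chi q.1 * conj (R.chi' q.2) *
      levelDC W (γ₀ : GA W) (p ^ (N + n₁))
        ((((q.1 : torusT W) : GA W))⁻¹ * GA.ofFinPart W (γ₀ : GA W) * ((q.2 : torusT' W) : GA W)))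
      (DZf ×ˢ Set.univ) (νf.prod νf')) :
    ChainInputs W R γ₀ νinf νf νinf' νf' DZf
      ((Setting.ofAdelicData W R μ DG fdG compG compT compT').conv
        (L1Class.prodFn W finf (ffinMuNat W μ₀ (γ₀ : GA W) (fun n => p ^ (n + n₁)) (p ^ (N + n₁))))
        (testNat W e (p ^ (N + n₁))))
      (fun x => (c₀ : ℂ) * convInf W μinf finf e x) (levelDC W (γ₀ : GA W) (p ^ (N + n₁))) := by
  have hN : p ^ (N + n₁) ≠ 0 := pow_ne_zero _ hp
  have hF := witness_isProductFn W R μ DG fdG compG compT compT' (γ₀ : GA W) μinf μ₀ c₀ hcμ₀ finf e p n₁ N hp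
  have hfin : L1Class.IsFinFactor W (levelDC W (γ₀ : GA W) (p ^ (N + n₁))) := isFinFactor_levelDC W _ hN
  -- the Poincaré clause of the witness from display (8): the witness IS `prodFn finf′ ffin`
  have hFeq : (Setting.ofAdelicData W R μ DG fdG compG compT compT').conv
      (L1Class.prodFn W finf (ffinMuNat W μ₀ (γ₀ : GA W) (fun n => p ^ (n + n₁)) (p ^ (N + n₁))))
      (testNat W e (p ^ (N + n₁))) =
      L1Class.prodFn W (fun x => (c₀ : ℂ) * convInf W μinf finf e x) (levelDC W (γ₀ : GA W) (p ^ (N + n₁))) :=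
    funext hF
  have hP := poincareSummable_of_poincareOfDecay W _ h8 hFinfc hdec hfin
  rw [← hFeq] at hP
  exact chainInputs_of_pieces W R hR hc hu hc' hu' compT compT' γ₀ νinf νf νinf' νf' DZf hF hFinfc C hC hfin hP hB1 hA hB
    hIinf hIfin hint

end Witness

end Summit.Ventures.HodgeRepro.Tier4.Line4
end
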